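import Literature.AlgebraicGeometry.Motives.AbelianVarietyBaseChange
import Literature.AlgebraicGeometry.Motives.BaseChange
import Literature.AlgebraicGeometry.Morphisms.ClopenPieceOfCoproduct
import HarnessLib

/-!
# COV-1: the tower isomorphism `(M ⊗_k K) ⊗_K L ≅ M ⊗_{k,ι} L` along a ring-homomorphism triangle, and coproduct cofans transported along an
# isomorphism of the apex ([GortzWedhorn2020] Prop. 4.16, §(4.7)–(4.8); [Hartshorne1977] II Thm. 3.3)

Layer `Literature/AlgebraicGeometry/Motives`, namespace `Literature.AlgebraicGeometry.Motives`.  THEOREMS ONLY (no definition, no named fact, no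
instance, no notation, no `sorry`).  Cell `hodgecm-mathlib` (D-0151), FLOOR 0, P6 «MOD» (crux hLiu418 = stmt-HodgeConjecture-24832, `--supports`), E6 closer
of `Cruxes/HLiu418/Lines/F0_P6a_PELWitnessE.lean`, socket Σ-AN `ReadsCReading`, census row **COV-1** (A-p06 (g33) `CENSUS-SigmaAN.v2`: «tower iso
`Xc ≅ (M_Kc)_{ι₁}` + the pieces cofan of `Xc` transported along an iso of the apex»; deal 01:17:46Z «(δ) COV-1 — YOURS»).  HC_CM is proved only modulo
the printed citations (2 remaining named inputs hLiu418 24832, h413 24833) until rung 0 closes; this file is generic and changes no count.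

THE MATHEMATICS.  For a `k`-algebra `K`, a ring homomorphism `σ : K → L` into a field and `ι := σ ∘ (k → K)`, the structure maps satisfy
`Spec σ ≫ Spec (k → K) = Spec ι`, so pasting of fibre squares ([GortzWedhorn2020] Prop. 4.16: `(M ×_k K) ×_K L ≅ M ×_k L`, Mathlib
`pullbackLeftPullbackSndIso` + `pullback.congrHom`) gives an isomorphism OVER `Spec L` between the iterated base change
`(baseChange K L).obj ((baseChange k K).obj M)` (with `Algebra K L := σ.toAlgebra`) and the one-step base change `(baseChangeHom ι).obj M`, commuting
with the projections to `M` (§1–§2).  A coproduct cofan is transported along any isomorphism of its apex (§3, `Cofan.ext`); hence the pieces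
`ι_q : X_q ⟶ M_ι` of a cofan decomposition of `M_ι` (the `pieces` clause of ★ `RecordSystemGS`, apex `(baseChangeHom ι₁).obj (S.M Kc)`) become the pieces
`ι_q ≫ e⁻¹` of the iterated base change `Xc := ((S.M Kc) ⊗_F Fᵢ) ⊗_{Fᵢ,τE} ℂ` — in `SchemeOver ℂ` and on underlying schemes (★ `isColimit_cofan_left`) —
which is the cover ★ ASM (b) `exists_hom_of_isColimit_cofan` glues over (§4).

* §1 (private) `specMap_comp_specMap_algebraMap_eq` — `Spec σ ≫ Spec (k → K) = Spec ι`.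
* §2 **`exists_towerIso_of_comp_eq`** — the iso `e` over `Spec L` with `e.hom.left ≫ pr_M = pr ≫ pr_M` and `e.inv.left ≫ pr ≫ pr_M = pr_M`.
* §3 (private) `Cofan.isColimit_of_iso_pt` — a cofan colimit transported along an iso of the apex (any category; plumbing).
* §4 **`exists_towerIso_isColimit_cofan_of_comp_eq`** — the Σ-AN shape: tower iso + transported cofan in `SchemeOver L` + its `.left` cofan.

## References
* [GortzWedhorn2020] U. Görtz, T. Wedhorn, *Algebraic Geometry I* (2nd ed. 2020), Prop. 4.16 (p. 101), Sections (4.7)–(4.8).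
* [Hartshorne1977] R. Hartshorne, *Algebraic Geometry* (1977), II §3 Theorem 3.3 (fibre products).
-/

set_option autoImplicit false
set_option backward.isDefEq.respectTransparency false  -- tree-standard hygiene (Mathlib `pullback.map`/`congrHom` simp seams)

noncomputable section

universe u

open CategoryTheory CategoryTheory.Limits AlgebraicGeometry

namespace Literature.AlgebraicGeometry.Motives

/-! ### §1 The structure maps of a ring-homomorphism triangle -/

/-- `Spec σ ≫ Spec (k → K) = Spec ι` when `σ ∘ (k → K) = ι` (`Spec` is contravariant; plumbing). [folklore] -/
private theorem specMap_comp_specMap_algebraMap_eq {k K L : Type u} [CommRing k] [CommRing K] [CommRing L] [Algebra k K]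
    (σ : K →+* L) (ι : k →+* L) (h : σ.comp (algebraMap k K) = ι) :
    Spec.map (CommRingCat.ofHom σ) ≫ Spec.map (CommRingCat.ofHom (algebraMap k K)) = Spec.map (CommRingCat.ofHom ι) := by
  rw [← Spec.map_comp, ← CommRingCat.ofHom_comp, h]

/-! ### §2 The tower isomorphism over `Spec L` -/

/-- **`(M ⊗_k K) ⊗_{K,σ} L ≅ M ⊗_{k,ι} L` OVER `Spec L`, commuting with the projections to `M`** ([GortzWedhorn2020] Prop. 4.16 pasting; Mathlib
`pullbackLeftPullbackSndIso` + `pullback.congrHom` + `Over.isoMk`).  Here `Algebra K L := σ.toAlgebra`, so the left side is the tree's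
`(baseChange K L).obj ((baseChange k K).obj M)` (structure map `bcSpec K L`), and the right side is `(baseChangeHom ι).obj M`.  In Σ-AN:
`k := F`, `K := Fᵢ`, `L := ℂ`, `σ := τE`, `ι := ι₁`, `h := hτE`, `M := S.M Kc`: `Xc ≅ (M_Kc)_{ι₁}`. [cite: GortzWedhorn2020, Prop. 4.16 (p. 101) and Section (4.7)]
[cite: Hartshorne1977, Ch. II §3 Theorem 3.3] -/
theorem exists_towerIso_of_comp_eq {k K L : Type u} [Field k] [Field K] [Field L] [Algebra k K]
    (σ : K →+* L) (ι : k →+* L) (h : σ.comp (algebraMap k K) = ι) (M : SchemeOver k) :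
    letI : Algebra K L := σ.toAlgebra
    ∃ e : (baseChange K L).obj ((baseChange k K).obj M) ≅ (baseChangeHom ι).obj M,
      e.hom.left ≫ pullback.fst M.hom (Spec.map (CommRingCat.ofHom ι)) =
        pullback.fst ((baseChange k K).obj M).hom (AbelianVariety.bcSpec K L) ≫ pullback.fst M.hom (AbelianVariety.bcSpec k K) ∧
      e.inv.left ≫ pullback.fst ((baseChange k K).obj M).hom (AbelianVariety.bcSpec K L) ≫ pullback.fst M.hom (AbelianVariety.bcSpec k K) =
        pullback.fst M.hom (Spec.map (CommRingCat.ofHom ι)) := by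
  letI : Algebra K L := σ.toAlgebra
  have hs : AbelianVariety.bcSpec K L ≫ AbelianVariety.bcSpec k K = Spec.map (CommRingCat.ofHom ι) :=
    specMap_comp_specMap_algebraMap_eq σ ι h
  -- the pasting isomorphism on underlying schemes
  let e₀ : ((baseChange K L).obj ((baseChange k K).obj M)).left ≅ ((baseChangeHom ι).obj M).left :=
    pullbackLeftPullbackSndIso M.hom (AbelianVariety.bcSpec k K) (AbelianVariety.bcSpec K L) ≪≫ pullback.congrHom rfl hs
  -- projection formulas, with the structure map of `M ⊗_k K` spelled `pullback.snd` (syntactic form of the Mathlib simp lemmas)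
  have hfst0 : e₀.hom ≫ pullback.fst M.hom (Spec.map (CommRingCat.ofHom ι)) =
      pullback.fst (pullback.snd M.hom (AbelianVariety.bcSpec k K)) (AbelianVariety.bcSpec K L) ≫
        pullback.fst M.hom (AbelianVariety.bcSpec k K) := by
    simp [e₀]
  have hsnd0 : e₀.hom ≫ pullback.snd M.hom (Spec.map (CommRingCat.ofHom ι)) =
      pullback.snd (pullback.snd M.hom (AbelianVariety.bcSpec k K)) (AbelianVariety.bcSpec K L) := by
    simp [e₀]
  have hfst : e₀.hom ≫ pullback.fst M.hom (Spec.map (CommRingCat.ofHom ι)) =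
      pullback.fst ((baseChange k K).obj M).hom (AbelianVariety.bcSpec K L) ≫ pullback.fst M.hom (AbelianVariety.bcSpec k K) :=
    hfst0
  have hsnd : e₀.hom ≫ ((baseChangeHom ι).obj M).hom = ((baseChange K L).obj ((baseChange k K).obj M)).hom := hsnd0
  have hinv : e₀.inv ≫ pullback.fst ((baseChange k K).obj M).hom (AbelianVariety.bcSpec K L) ≫
      pullback.fst M.hom (AbelianVariety.bcSpec k K) = pullback.fst M.hom (Spec.map (CommRingCat.ofHom ι)) := by
    have h1 := congrArg (fun x => e₀.inv ≫ x) hfst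
    simp only [e₀.inv_hom_id_assoc] at h1
    exact h1.symm
  exact ⟨Over.isoMk e₀ hsnd, hfst, hinv⟩

/-! ### §3 Cofans transported along an isomorphism of the apex -/

/-- **A coproduct cofan stays a colimit when its apex is replaced along an isomorphism** (legs `f i ≫ e.hom`; Mathlib `Cofan.ext` +
`IsColimit.ofIsoColimit`). [folklore] -/
private theorem Cofan.isColimit_of_iso_pt {C : Type*} [Category C] {β : Type*} {F : β → C} {X Y : C} {f : ∀ i, F i ⟶ X}
    (hc : IsColimit (Cofan.mk X f)) (e : X ≅ Y) : Nonempty (IsColimit (Cofan.mk Y fun i => f i ≫ e.hom)) :=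
  ⟨IsColimit.ofIsoColimit hc (Cofan.ext e fun _ => rfl)⟩

/-! ### §4 The Σ-AN shape: the pieces of `(M ⊗_k K) ⊗_K L` from the pieces of `M ⊗_{k,ι} L` -/

/-- **COV-1 — THE PIECES OF THE ITERATED BASE CHANGE.**  With `σ ∘ (k → K) = ι` and a cofan decomposition `leg q : X q ⟶ (baseChangeHom ι).obj M` of
the one-step base change (the `pieces` clause of ★ `RecordSystemGS` at `ι := ι₁`), there is the tower iso `e` of §2 (with its two projection
formulas) such that the transported legs `leg q ≫ e.inv` form a colimit cofan of `(baseChange K L).obj ((baseChange k K).obj M)` in `SchemeOver L`,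
and their underlying scheme maps `(leg q ≫ e.inv).left` a colimit cofan of its underlying scheme (★ `Morphisms.isColimit_cofan_left`) — the cover
★ ASM (b) `exists_hom_of_isColimit_cofan` glues endomorphisms over. [cite: GortzWedhorn2020, Prop. 4.16 (p. 101) and Section (4.7)]
[cite: Hartshorne1977, Ch. II §3 Theorem 3.3] -/
theorem exists_towerIso_isColimit_cofan_of_comp_eq {k K L : Type} [Field k] [Field K] [Field L] [Algebra k K]
    (σ : K →+* L) (ι : k →+* L) (h : σ.comp (algebraMap k K) = ι) (M : SchemeOver k)
    {Q : Type} (X : Q → SchemeOver L) (leg : ∀ q, X q ⟶ (baseChangeHom ι).obj M)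
    (hc : IsColimit (Cofan.mk ((baseChangeHom ι).obj M) leg)) :
    letI : Algebra K L := σ.toAlgebra
    ∃ e : (baseChange K L).obj ((baseChange k K).obj M) ≅ (baseChangeHom ι).obj M,
      e.hom.left ≫ pullback.fst M.hom (Spec.map (CommRingCat.ofHom ι)) =
        pullback.fst ((baseChange k K).obj M).hom (AbelianVariety.bcSpec K L) ≫ pullback.fst M.hom (AbelianVariety.bcSpec k K) ∧
      e.inv.left ≫ pullback.fst ((baseChange k K).obj M).hom (AbelianVariety.bcSpec K L) ≫ pullback.fst M.hom (AbelianVariety.bcSpec k K) =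
        pullback.fst M.hom (Spec.map (CommRingCat.ofHom ι)) ∧
      Nonempty (IsColimit (Cofan.mk ((baseChange K L).obj ((baseChange k K).obj M)) fun q => leg q ≫ e.inv)) ∧
      Nonempty (IsColimit (Cofan.mk ((baseChange K L).obj ((baseChange k K).obj M)).left fun q => (leg q ≫ e.inv).left)) := by
  letI : Algebra K L := σ.toAlgebra
  obtain ⟨e, hfst, hinv⟩ := exists_towerIso_of_comp_eq σ ι h M
  obtain ⟨hc'⟩ := Cofan.isColimit_of_iso_pt hc e.symm
  exact ⟨e, hfst, hinv, ⟨hc'⟩, Literature.AlgebraicGeometry.Morphisms.isColimit_cofan_left hc'⟩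

end Literature.AlgebraicGeometry.Motives

end
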